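import Summits.Parity.BatemanHorn.Theses.RoughParitySectors
import Summits.Parity.GeneralizedHardyLittlewood.Theorems.LeeYangFibresAbsoluteUpgradeSinglesDecayRemainder
import Literature.NumberTheory.Sieve.AletheiaZomleferFukshanskyGarcia2020ApplicationsBrunSieveProofs
import HarnessLib

/-!
# Crux `RoughParitySectors.RoughParityBalance` (stmt-Parity-15627), line `registered`:
# engine stub E3 `stub_linearClassSums`

Liouville class sums along a LINEAR member `fᵢ = aX + b` (`a ≥ 1`) of a Bateman–Horn system
`f = (f₁,…,f_k)`, averaged over the squarefree moduli `d ≤ x^{1/8}` with the root classes of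
`∏ fⱼ` modulo `d`: for every `A` there is `C` with, eventually in `x : ℕ`,

  `Σ_{d ≤ x^{1/8}, d squarefree} Σ_{c mod d, d ∣ ∏fⱼ(c)} |Σ_{1 ≤ n ≤ x, n ≡ c (d)} λ((a n + b)⁺)| ≤ C x/(log x)^A`.

This is the landed engine
`Summit.Parity.GeneralizedHardyLittlewood.Theorems.AbsoluteUpgrade.classSums_le` (class sums of `λ`
along a form, averaged over squarefree moduli with root-count weights; Bombieri–Vinogradov for `λ`)
specialised to `F = ∏ fⱼ` (root bound `Σ deg fⱼ` at every prime: no fixed prime divisor gives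
`ω_F(p) < p`, then Lagrange), the value height `(a + |b|) x`, the level `⌊x^{1/8}⌋₊`
(`a ⌊x^{1/8}⌋₊ ≤ x^{1/4}` once `x^{1/8} ≥ a`), after discarding the `n ≥ 1` with `a n + b ≤ 0`
(there `λ((a n + b)⁺) = λ(0) = 0`) and reindexing the natural interval as an integer interval.

References: H. Halberstam, H.-E. Richert, *Sieve Methods* (1974), §5.7; H. Iwaniec, E. Kowalski,
*Analytic Number Theory* (2004), Thm. 17.4.
-/

namespace Summit.Parity.BatemanHorn.Cruxes.RoughParityBalance.Birth

open scoped BigOperators Topology Classical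
open Filter Finset
open Literature.NumberTheory.Sieve

/-- Root bound for the product of a Bateman–Horn system: `ω_{∏ fⱼ}(p) ≤ Σ deg fⱼ` at every prime `p`
(no fixed prime divisor gives `ω < p`, then Lagrange for `∏ fⱼ mod p ≠ 0`). [folklore] -/
theorem linearClassSums_rootBound {k : ℕ} {f : Fin k → Polynomial ℤ} (hf : IsBatemanHornSystem f)
    (p : ℕ) (hp : p.Prime) : polyRootCountMod ![∏ j, f j] p ≤ ∑ j, (f j).natDegree := by
  have hlt := hf.hasNoFixedPrimeDivisor p hp
  rw [PolyPrimeCountBrun.polyRootCountMod_eq_single_prod] at hlt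
  exact (PolyPrimeCountBrun.polyRootCountMod_single_le_natDegree_of_lt hp hlt).trans
    (Polynomial.natDegree_prod_le _ _)

/-- A polynomial of degree `1` is the linear form `P(n) = a n + b` with `a` its leading coefficient and
`b = P(0)`. [folklore] -/
theorem linearClassSums_eval {P : Polynomial ℤ} (hP : P.natDegree = 1) (n : ℤ) :
    P.eval n = P.leadingCoeff * n + P.coeff 0 := by
  have h := Polynomial.eq_X_add_C_of_natDegree_le_one hP.le
  have hlc : P.leadingCoeff = P.coeff 1 := by rw [Polynomial.leadingCoeff, hP]
  rw [hlc]
  calc P.eval n = (Polynomial.C (P.coeff 1) * Polynomial.X + Polynomial.C (P.coeff 0)).eval n := by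
        rw [← h]
    _ = P.coeff 1 * n + P.coeff 0 := by
        simp only [Polynomial.eval_add, Polynomial.eval_mul, Polynomial.eval_C, Polynomial.eval_X]

/-- Reindexing a residue-class sum over a natural interval as one over an integer interval: for
`c < d`, `Σ_{n ∈ [n₁, x] ⊆ ℕ, n % d = c} g(n) = Σ_{m ∈ [n₁, x] ⊆ ℤ, m ≡ c (mod d)} g(m)`. [folklore] -/
theorem linearClassSums_reindex (g : ℤ → ℝ) {d c : ℕ} (hc : c < d) (n₁ x : ℕ) :
    ∑ n ∈ (Icc n₁ x).filter (fun n : ℕ => n % d = c), g n =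
      ∑ m ∈ (Icc (n₁ : ℤ) (x : ℤ)).filter (fun m : ℤ => m ≡ (c : ℤ) [ZMOD d]), g m := by
  have key : ∀ n : ℕ, n % d = c ↔ (n : ℤ) ≡ (c : ℤ) [ZMOD d] := fun n => by
    rw [Int.natCast_modEq_iff, Nat.ModEq, Nat.mod_eq_of_lt hc]
  refine Finset.sum_nbij' (fun n : ℕ => (n : ℤ)) (fun m : ℤ => m.toNat) ?_ ?_ ?_ ?_ ?_
  · intro n hn
    simp only [mem_filter, mem_Icc] at hn ⊢
    exact ⟨⟨by exact_mod_cast hn.1.1, by exact_mod_cast hn.1.2⟩, (key n).1 hn.2⟩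
  · intro m hm
    simp only [mem_filter, mem_Icc] at hm ⊢
    obtain ⟨⟨h1, h2⟩, h3⟩ := hm
    have hmc : ((m.toNat : ℕ) : ℤ) = m := Int.toNat_of_nonneg (le_trans (Int.natCast_nonneg n₁) h1)
    refine ⟨⟨by omega, by omega⟩, ?_⟩
    rw [key, hmc]
    exact h3
  · intro n _
    exact Int.toNat_natCast n
  · intro m hm
    simp only [mem_filter, mem_Icc] at hm
    exact Int.toNat_of_nonneg (le_trans (Int.natCast_nonneg n₁) hm.1.1)
  · intro n _
    rfl

/-- **Engine stub E3 — `stub_linearClassSums` (Liouville class sums along a LINEAR member, averaged over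
squarefree moduli `≤ x^{1/8}` with the root classes of `∏ fⱼ`).**  For every Bateman–Horn system `f`,
every linear member `fᵢ = aX + b` and every `A` there is `C` with, eventually in `x`,
`Σ_{d ≤ x^{1/8} sqfree} Σ_{c mod d, d ∣ ∏fⱼ(c)} |Σ_{n ≤ x, n ≡ c (d)} λ((a n + b)⁺)| ≤ C x/(log x)^A`
(`λ = ArithmeticFunction.liouville`, `(·)⁺ = Int.toNat`, so terms with `a n + b ≤ 0` vanish).  Proof: the
landed GHL engine `AbsoluteUpgrade.classSums_le` with `F = ∏ fⱼ`, root bound `B = Σ deg fⱼ`,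
`t = ⌈A⌉₊`, `m₁ =` the least `n ≥ 1` with `a n + b ≥ 1`, `m₂ = x`, value height `(a + |b|) x`, level
`⌊x^{1/8}⌋₊`; reindex `ℕ ↔ ℤ` and drop the `1 + ·`. [folklore] -/
theorem stub_linearClassSums :
    ∀ (k : ℕ) (f : Fin k → Polynomial ℤ), IsBatemanHornSystem f →
      ∀ i : Fin k, (f i).natDegree = 1 → ∀ A : ℝ, ∃ C : ℝ, ∀ᶠ x : ℕ in Filter.atTop,
        ∑ d ∈ (Finset.Icc 1 ⌊(x : ℝ) ^ (1 / 8 : ℝ)⌋₊).filter Squarefree,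
          ∑ c ∈ (Finset.range d).filter (fun c : ℕ => (d : ℤ) ∣ (∏ j, f j).eval (c : ℤ)),
            |∑ n ∈ (Finset.Icc 1 x).filter (fun n : ℕ => n % d = c),
              (ArithmeticFunction.liouville (((f i).eval (n : ℤ)).toNat) : ℝ)| ≤
          C * x / Real.log x ^ A := by
  intro k f hf i hdeg A
  -- the linear form `fᵢ = a X + b`, `a ≥ 1`
  set a : ℤ := (f i).leadingCoeff with ha
  set b : ℤ := (f i).coeff 0 with hb
  have ha0 : 0 < a := hf.leadingCoeff_pos i
  have heval : ∀ n : ℤ, (f i).eval n = a * n + b := linearClassSums_eval hdeg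
  set α : ℕ := a.natAbs with hα
  have hαa : (α : ℤ) = a := Int.natAbs_of_nonneg ha0.le
  have hα1 : 1 ≤ α := Int.natAbs_pos.mpr ha0.ne'
  have hαR : ((a : ℤ) : ℝ) = (α : ℝ) := by rw [← hαa, Int.cast_natCast]
  have hα1R : (1 : ℝ) ≤ α := by exact_mod_cast hα1
  -- the first index `n₁ ≥ 1` with `a n₁ + b ≥ 1`
  have hex : ∃ n : ℕ, 1 ≤ n ∧ 1 ≤ a * (n : ℤ) + b := by
    refine ⟨(1 - b).toNat + 1, Nat.succ_le_succ (Nat.zero_le _), ?_⟩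
    have h1 : 1 - b ≤ (((1 - b).toNat : ℕ) : ℤ) := Int.self_le_toNat (1 - b)
    have h2 : (0 : ℤ) ≤ (((1 - b).toNat : ℕ) : ℤ) := Int.natCast_nonneg _
    push_cast
    nlinarith
  set n₁ := Nat.find hex with hn₁
  have hn₁spec : 1 ≤ n₁ ∧ 1 ≤ a * (n₁ : ℤ) + b := Nat.find_spec hex
  have hn₁min : ∀ n : ℕ, 1 ≤ n → n < n₁ → a * (n : ℤ) + b ≤ 0 := fun n h1 hlt => by
    have h : ¬(1 ≤ a * (n : ℤ) + b) := fun h' => Nat.find_min hex hlt ⟨h1, h'⟩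
    have h' := not_le.mp h
    omega
  -- the root bound and the engine
  set B : ℕ := ∑ j, (f j).natDegree with hB
  have hroot : ∀ p : ℕ, p.Prime → polyRootCountMod ![∏ j, f j] p ≤ B := fun p hp =>
    linearClassSums_rootBound hf p hp
  set t : ℕ := ⌈A⌉₊ with ht
  have htA : A ≤ ((t + 3 : ℕ) : ℝ) := by
    have := Nat.le_ceil A
    push_cast
    linarith
  obtain ⟨C₀, x₀, hE⟩ :=
    Summit.Parity.GeneralizedHardyLittlewood.Theorems.AbsoluteUpgrade.classSums_le B t
  set K : ℝ := (α : ℝ) + |(b : ℝ)| with hK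
  have hK1 : 1 ≤ K := by rw [hK]; linarith [abs_nonneg (b : ℝ)]
  set C₁ : ℝ := max C₀ 0 with hC₁
  have hC₁0 : 0 ≤ C₁ := le_max_right _ _
  refine ⟨C₁ * K, ?_⟩
  -- eventually: `x ≥ n₁`, `x ≥ x₀`, `log x ≥ 1`, `x^{1/8} ≥ a`
  have h1 : ∀ᶠ x : ℕ in atTop, n₁ ≤ x := eventually_ge_atTop n₁
  have h2 : ∀ᶠ x : ℕ in atTop, x₀ ≤ (x : ℝ) := tendsto_natCast_atTop_atTop.eventually_ge_atTop x₀
  have h3 : ∀ᶠ x : ℕ in atTop, (1 : ℝ) ≤ Real.log x :=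
    (Real.tendsto_log_atTop.comp tendsto_natCast_atTop_atTop).eventually_ge_atTop 1
  have h4 : ∀ᶠ x : ℕ in atTop, (α : ℝ) ≤ (x : ℝ) ^ (1 / 8 : ℝ) :=
    ((tendsto_rpow_atTop (by norm_num : (0 : ℝ) < 1 / 8)).comp
      tendsto_natCast_atTop_atTop).eventually_ge_atTop _
  filter_upwards [h1, h2, h3, h4] with x hx₁ hx₀ hlog hx8
  -- basic facts about `x`
  have hx1 : (1 : ℝ) ≤ x := by exact_mod_cast hn₁spec.1.trans hx₁
  have hx0 : (0 : ℝ) < x := by linarith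
  have hlog0 : 0 < Real.log x := by linarith
  have hxK : (x : ℝ) ≤ K * x := le_mul_of_one_le_left hx0.le hK1
  have hKx0 : 0 < K * x := by positivity
  -- the hypotheses of the engine at value height `K x`
  have hpos : ∀ m ∈ Icc (n₁ : ℤ) (x : ℤ), 1 ≤ a * m + b := fun m hm => by
    rw [Finset.mem_Icc] at hm
    have := mul_le_mul_of_nonneg_left hm.1 ha0.le
    linarith [hn₁spec.2]
  have hle : ∀ m ∈ Icc (n₁ : ℤ) (x : ℤ), ((a * m + b : ℤ) : ℝ) ≤ K * x := fun m hm => by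
    rw [Finset.mem_Icc] at hm
    have hmx : ((m : ℤ) : ℝ) ≤ (x : ℝ) := by exact_mod_cast hm.2
    push_cast
    rw [hαR, hK, add_mul]
    have h1 : (α : ℝ) * m ≤ α * x := mul_le_mul_of_nonneg_left hmx (by positivity)
    have h2 : ((b : ℤ) : ℝ) ≤ |((b : ℤ) : ℝ)| * x :=
      (le_abs_self _).trans (le_mul_of_one_le_right (abs_nonneg _) hx1)
    linarith
  have hlevel : ((a.natAbs * ⌊(x : ℝ) ^ (1 / 8 : ℝ)⌋₊ : ℕ) : ℝ) ≤ (K * x) ^ (1 / 4 : ℝ) := by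
    rw [← hα, Nat.cast_mul]
    calc (α : ℝ) * (⌊(x : ℝ) ^ (1 / 8 : ℝ)⌋₊ : ℕ)
        ≤ (x : ℝ) ^ (1 / 8 : ℝ) * (x : ℝ) ^ (1 / 8 : ℝ) :=
          mul_le_mul hx8 (Nat.floor_le (by positivity)) (by positivity) (by positivity)
      _ = (x : ℝ) ^ (1 / 4 : ℝ) := by rw [← Real.rpow_add hx0]; norm_num
      _ ≤ (K * x) ^ (1 / 4 : ℝ) := Real.rpow_le_rpow hx0.le hxK (by norm_num)
  have hmain := hE (K * x) (hx₀.trans hxK) (∏ j, f j) hroot a b (n₁ : ℤ) (x : ℤ) ha0.ne'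
    (by exact_mod_cast hx₁) hpos hle ⌊(x : ℝ) ^ (1 / 8 : ℝ)⌋₊ hlevel
  -- the inner sums: discard `1 ≤ n < n₁` (zero terms) and reindex `ℕ ↔ ℤ`
  have hinner : ∀ d c : ℕ, c < d →
      ∑ n ∈ (Icc 1 x).filter (fun n : ℕ => n % d = c),
          (ArithmeticFunction.liouville (((f i).eval (n : ℤ)).toNat) : ℝ) =
        ∑ m ∈ (Icc (n₁ : ℤ) (x : ℤ)).filter (fun m : ℤ => m ≡ (c : ℤ) [ZMOD d]),
          (ArithmeticFunction.liouville (a * m + b).toNat : ℝ) := by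
    intro d c hcd
    have hsub : (Icc n₁ x).filter (fun n : ℕ => n % d = c) ⊆ (Icc 1 x).filter (fun n : ℕ => n % d = c) :=
      filter_subset_filter _ (Icc_subset_Icc_left hn₁spec.1)
    have hzero : ∀ n ∈ (Icc 1 x).filter (fun n : ℕ => n % d = c),
        n ∉ (Icc n₁ x).filter (fun n : ℕ => n % d = c) →
          (ArithmeticFunction.liouville (((f i).eval (n : ℤ)).toNat) : ℝ) = 0 := by
      intro n hn hn'
      simp only [mem_filter, mem_Icc] at hn hn'
      have hlt : n < n₁ := by
        by_contra h
        exact hn' ⟨⟨not_lt.mp h, hn.1.2⟩, hn.2⟩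
      have h0 : ((f i).eval (n : ℤ)).toNat = 0 := by
        rw [Int.toNat_eq_zero, heval]
        exact hn₁min n hn.1.1 hlt
      rw [h0, ArithmeticFunction.map_zero, Int.cast_zero]
    calc ∑ n ∈ (Icc 1 x).filter (fun n : ℕ => n % d = c),
          (ArithmeticFunction.liouville (((f i).eval (n : ℤ)).toNat) : ℝ)
        = ∑ n ∈ (Icc n₁ x).filter (fun n : ℕ => n % d = c),
            (ArithmeticFunction.liouville (((f i).eval (n : ℤ)).toNat) : ℝ) :=
          (Finset.sum_subset hsub hzero).symm
      _ = ∑ m ∈ (Icc (n₁ : ℤ) (x : ℤ)).filter (fun m : ℤ => m ≡ (c : ℤ) [ZMOD d]),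
            (ArithmeticFunction.liouville ((f i).eval m).toNat : ℝ) :=
          linearClassSums_reindex
            (fun m : ℤ => (ArithmeticFunction.liouville ((f i).eval m).toNat : ℝ)) hcd n₁ x
      _ = _ := by simp only [heval]
  -- assembly
  have hpowA : Real.log x ^ A ≤ Real.log x ^ (t + 3) := by
    rw [← Real.rpow_natCast]
    exact Real.rpow_le_rpow_of_exponent_le hlog htA
  have hpowA0 : 0 < Real.log x ^ A := Real.rpow_pos_of_pos hlog0 A
  have hlogK : Real.log x ≤ Real.log (K * x) := Real.log_le_log hx0 hxK
  calc ∑ d ∈ (Icc 1 ⌊(x : ℝ) ^ (1 / 8 : ℝ)⌋₊).filter Squarefree,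
        ∑ c ∈ (range d).filter (fun c : ℕ => (d : ℤ) ∣ (∏ j, f j).eval (c : ℤ)),
          |∑ n ∈ (Icc 1 x).filter (fun n : ℕ => n % d = c),
            (ArithmeticFunction.liouville (((f i).eval (n : ℤ)).toNat) : ℝ)|
      = ∑ d ∈ (Icc 1 ⌊(x : ℝ) ^ (1 / 8 : ℝ)⌋₊).filter Squarefree,
          ∑ c ∈ Summit.Parity.GeneralizedHardyLittlewood.Theorems.AbsoluteUpgrade.rootsMod (∏ j, f j) d,
            |∑ m ∈ (Icc (n₁ : ℤ) (x : ℤ)).filter (fun m : ℤ => m ≡ (c : ℤ) [ZMOD d]),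
              (ArithmeticFunction.liouville (a * m + b).toNat : ℝ)| := by
        refine Finset.sum_congr rfl fun d _ => Finset.sum_congr rfl fun c hc => ?_
        rw [Summit.Parity.GeneralizedHardyLittlewood.Theorems.AbsoluteUpgrade.mem_rootsMod] at hc
        rw [hinner d c hc.1]
    _ ≤ ∑ d ∈ (Icc 1 ⌊(x : ℝ) ^ (1 / 8 : ℝ)⌋₊).filter Squarefree,
          ∑ c ∈ Summit.Parity.GeneralizedHardyLittlewood.Theorems.AbsoluteUpgrade.rootsMod (∏ j, f j) d,
            (1 + |∑ m ∈ (Icc (n₁ : ℤ) (x : ℤ)).filter (fun m : ℤ => m ≡ (c : ℤ) [ZMOD d]),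
              (ArithmeticFunction.liouville (a * m + b).toNat : ℝ)|) :=
        Finset.sum_le_sum fun d _ => Finset.sum_le_sum fun c _ => by linarith
    _ ≤ C₀ * (K * x) / Real.log (K * x) ^ (t + 3) := hmain
    _ ≤ C₁ * (K * x) / Real.log (K * x) ^ (t + 3) := by
        refine div_le_div_of_nonneg_right ?_ (pow_nonneg (hlog0.le.trans hlogK) _)
        exact mul_le_mul_of_nonneg_right (le_max_left _ _) hKx0.le
    _ ≤ C₁ * (K * x) / Real.log x ^ (t + 3) :=
        div_le_div_of_nonneg_left (by positivity) (pow_pos hlog0 _)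
          (pow_le_pow_left₀ hlog0.le hlogK _)
    _ ≤ C₁ * (K * x) / Real.log x ^ A :=
        div_le_div_of_nonneg_left (by positivity) hpowA0 hpowA
    _ = C₁ * K * x / Real.log x ^ A := by ring

end Summit.Parity.BatemanHorn.Cruxes.RoughParityBalance.Birth
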